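import Literature.RingTheory.CohomologyAnnihilator.JacobianIdealAnnihilator
import HarnessLib

/-!
# Companion of `JacobianIdealAnnihilator.lean` (FACT F-89a `jacobianFloor_normal_dim3`): the two PROVED corollaries kept out of the
# statement-only file — elementwise unfolding and transport to localisations (res-D-lit-1 hand-over 85208dd3b0eae812, typer res-L1-s13-pv-1)

Nothing new is assumed: `smul_ext_eq_zero` unfolds the fact through `smul_eq_zero_of_mem_cohomologyAnnihilatorOfDegree`;
`of_isLocalization` transports it along a localisation `T = S⁻¹B` (Fitting ideals of Kähler differentials localise,
`Module.fittingIdeal_kaehlerDifferential_of_isLocalization'`; `caⁿ(B)·T ⊆ caⁿ(T)` [IyengarTakahashi2014, Lemma 2.10(1)] =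
`map_cohomologyAnnihilatorOfDegree_le_of_isLocalization`). AI bookkeeping weaker than expert review.
-/

noncomputable section

open CategoryTheory CategoryTheory.Abelian
open Literature.RingTheory.FittingIdeal

universe u

namespace Literature.RingTheory.CohomologyAnnihilator

namespace jacobianFloor_normal_dim3

variable {k : Type u} [Field k] [PerfectField k]

/-- Elementwise form of the fact: an element of the Jacobian ideal `Fitt₃(Ω[B⁄k])` of a normal
affine `3`-dimensional domain `B` kills every `Extⁱ_B(M, N)`, `i ≥ 4`, `M`, `N` finitely generated.
[cite: IyengarTakahashi2016, Thm 1.2 (= Thm 3.8) and Ex. 3.2] -/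
theorem smul_ext_eq_zero (h : jacobianFloor_normal_dim3 k) {B : Type u} [CommRing B]
    [IsDomain B] [Algebra k B] (hB : Algebra.FiniteType k B) (hn : IsIntegrallyClosed B)
    (hd : ringKrullDim B = 3) {x : B} (hx : x ∈ Module.fittingIdeal B (Ω[B⁄k]) 3) {i : ℕ}
    (hi : 4 ≤ i) {M N : ModuleCat.{u} B} [Module.Finite B M] [Module.Finite B N]
    (e : Ext.{u} M N i) : x • e = 0 :=
  smul_eq_zero_of_mem_cohomologyAnnihilatorOfDegree (h B hB hn hd hx) hi e

/-- Transport to localisations: under the fact, for every localisation `T = S⁻¹B` of a normal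
affine `3`-dimensional domain `B` one still has `Fitt₃(Ω[T⁄k]) ≤ ca⁴(T)` — Fitting ideals of
Kähler differentials localise (`Module.fittingIdeal_kaehlerDifferential_of_isLocalization'`) and
`ca⁴(B)·T ⊆ ca⁴(T)` [IyengarTakahashi2014, Lemma 2.10(1)]. (Cf. the localisation step in the proof
of [IyengarTakahashi2016, Cor. 3.5].) [cite: IyengarTakahashi2014, Lemma 2.10(1)] -/
theorem of_isLocalization (h : jacobianFloor_normal_dim3 k) {B : Type u} [CommRing B]
    [IsDomain B] [Algebra k B] (hB : Algebra.FiniteType k B) (hn : IsIntegrallyClosed B)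
    (hd : ringKrullDim B = 3) (S : Submonoid B) (T : Type u) [CommRing T] [Algebra k T]
    [Algebra B T] [IsScalarTower k B T] [IsLocalization S T] :
    Module.fittingIdeal T (Ω[T⁄k]) 3 ≤ cohomologyAnnihilatorOfDegree T 4 := by
  haveI : Algebra.FiniteType k B := hB
  haveI : IsNoetherianRing B := Algebra.FiniteType.isNoetherianRing k B
  rw [Module.fittingIdeal_kaehlerDifferential_of_isLocalization' (A := k) (B' := T) S 3]
  exact (Ideal.map_mono (h B hB hn hd)).trans
    (map_cohomologyAnnihilatorOfDegree_le_of_isLocalization S T 4)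

end jacobianFloor_normal_dim3

end Literature.RingTheory.CohomologyAnnihilator

end
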